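import Mathlib
import Literature.Analysis.FluidPDE.Tao2016AveragedNS.ShiftSetCascadeFlows
import Literature.Analysis.FluidPDE.Tao2016AveragedNS.ShiftSetCascadeFlux
import Summits.NavierStokesRegularity.NavierStokesRegularity.Theorems.TaoLadderRungTwoFlatCertificateGlueReadoutLOn
import HarnessLib

/-!
# Certificate glue on a shift set `𝕊`, XXXIV-d: READOUT-L, SOUNDNESS — `read_of_checkReadoutL`: every state whose weighted coordinates lie in the
  section-node parallelepiped `XS + CS ξ + e` passes the readout clause `hread` of glue IX / XXXI with the state-dependent amplitude `a' = A(x)/Cs` and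
  the clipped reference state `z' = Cs·clip(read state; [cen ∓ chw])`, provided `InCoreBox ⊆ Core` (helper for items stmt-NavierStokesRegularity-22987
  `FlatGapCertificatesV2` (crux K_A♭ of route TaoLadderRungTwoFlat) and stmt-24295 K_A₂(64); cell harvest/h2-tao-ladder, p1 g17; theory-1 g29 ask A-77 §3;
  referee c73 W-8 «the load-bearing unproved piece read_of_checkReadoutL»)

Proof route (A-77 §3): `|A(x) − Â| ≤ δA` on the node; floor from the rational `a_lo` (glue XXXIV `floor_of_pow_test`); slack through `a' ≤ a_hi` and
`|x_{d₁}| ≥ |XS| − RS`; matching by the derivative-free identity `P − P̂ = ω(Â v_{d⁺} − XS_{d⁺} A(v))/(A(x) Â)` with `|Â v_{d⁺} − XS_{d⁺} A(v)| ≤ N`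
expanded over the generators `ξ, e`, then `|t − clip t| ≤ (|t − c| − h)⁺`; top with `|clip 0| ≤ (|c| − h)⁺`; exit through `a_lo ≤ a'`. Conclusion
IDENTICAL to glue XXXIV `read_of_checkReadout`.

HONEST FRAMING: Tao-type MODEL lattices (Tao 2016 §4/§6 vocabulary, shift-set parametrised); checker soundness — NO certificate instance exists in the
tree, nothing is certified here, no stub is closed, nothing here is a statement about the Navier–Stokes equations.
-/

-- the sub-problem namespace repeats the summit name by design (D-0017)
set_option linter.dupNamespace false

namespace Summit.NavierStokesRegularity.NavierStokesRegularity.Theorems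

open Set Finset Literature.Analysis.FluidPDE Literature.Analysis.FluidPDE.TaoCascade
open Summit.NavierStokesRegularity.NavierStokesRegularity.Theorems.TaylorModelCert

namespace CertificateGlueOn

variable {m : ℕ} {Kb Ka : ℤ}

/-! ### Soundness of READOUT-L -/

/-- **SOUNDNESS OF THE READOUT-L TEST** (theory-1 A-77 §3): every state whose weighted coordinates lie in the parallelepiped `XS + CS ξ + e`
(`|ξ| ≤ r`, `|e| ≤ ES`) satisfies the readout clause `hread` of glue XXXI `hland_of_branchMeshes'` (`w := wq`, `ε₀ := q`, `θ₀ := θn/θd`) with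
the STATE-DEPENDENT amplitude `a' = A(x)/Cs` and the reference state `z' = Cs·clip(read state; [cen ∓ chw])` (zero off the window, `Cs·clip(0)`
at `k = Ka`), provided every `InCoreBox` state is in `Core`. Conclusion identical to glue XXXIV `read_of_checkReadout`.
[cite: Tao2016AveragedNS, §6.3–6.4 Props. 6.4–6.5 (statement shape; the readout clauses); cell certificate format, readout checker L] -/
theorem read_of_checkReadoutL (hKb : 0 ≤ Kb) (hKa : 1 ≤ Ka) {ωq : Fin m → ℤ → ℚ} (hω : ∀ i k, 0 < ωq i k)
    {Core : (Fin m → ℤ → ℝ) → Prop} {i₀ : Fin m} {q σ ρ r Zx Et Cs : ℚ} {θn θd : ℕ} {wq : ℤ → ℚ}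
    {ell cen chw rD : Array Dyad} {XS ES : Array ℚ} {CS : Array (Array ℚ)} (hq : 0 < 1 + (q : ℝ))
    (hc : checkReadoutL m Kb Ka ωq i₀ q σ ρ r Zx Et θn θd wq Cs ell cen chw XS CS rD ES = true)
    (hcoreL : ∀ z : Fin m → ℤ → ℝ, InCoreBox Kb Ka Cs cen chw z → Core z)
    {y : Fin m → ℤ → ℝ}
    (hy : PInParaV Kb Ka (fun i k => (ωq i k : ℝ)) (fun c => (XS.getD c 0 : ℝ))
      (Matrix.of fun c col => (qmgetD CS c col : ℝ)) (fun col => (dgetD rD col).toReal) (fun c => (ES.getD c 0 : ℝ)) y) :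
    ∃ (a' : ℝ) (z' : Fin m → ℤ → ℝ), 0 < a' ∧ (1 + (q : ℝ)) ^ (-((θn : ℝ) / (θd : ℝ))) ≤ a' ∧ (1 + (σ : ℝ)) * a' ≤ |y i₀ 1| ∧ Core z' ∧
      (∀ i k, -Kb ≤ k → k + 1 ≤ Ka → (wq k : ℝ) * |y i (1 + k) / a' - z' i k| ≤ (ρ : ℝ) * (r : ℝ)) ∧
      (∀ (i : Fin m) (v : ℝ), |v| ≤ (Et : ℝ) → (wq Ka : ℝ) * |v / a' - z' i Ka| ≤ (ρ : ℝ) * (r : ℝ)) ∧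
      (∀ i, |y i (-Kb)| ≤ a' * (Zx : ℝ)) := by
  have hKK : 0 ≤ Ka + Kb + 1 := by omega
  simp only [checkReadoutL, Bool.and_eq_true, Bool.or_eq_true, decide_eq_true_eq, List.all_eq_true, List.mem_finRange, List.mem_range,
    true_implies] at hc
  obtain ⟨⟨⟨⟨⟨⟨⟨⟨⟨⟨hθd, hCs⟩, hZx⟩, hρr⟩, hσ1⟩, hAlo⟩, hfl⟩, h1w⟩, ⟨hsl1, hsl2⟩⟩, hmatch⟩, htopexit⟩ := hc
  -- names for the rational pieces
  set Lam : Array ℚ := lamArr Kb Ka ωq ell with hLam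
  set Ah : ℚ := ahatQ (m * winLen Kb Ka) Lam XS with hAh
  set AC : Array ℚ := acArr (m * winLen Kb Ka) Lam CS with hAC
  set dA : ℚ := dAQ (m * winLen Kb Ka) Lam AC rD ES with hdA
  -- the real-side objects
  obtain ⟨ξ, e, hξ, he, hx⟩ := hy
  set ω : Fin m → ℤ → ℝ := fun i k => (ωq i k : ℝ) with hωdef
  set x : Fin (m * winLen Kb Ka) → ℝ := pxcoord Kb Ka ω y with hxdef
  set CSr : Matrix (Fin (m * winLen Kb Ka)) (Fin (m * winLen Kb Ka)) ℝ := Matrix.of fun c col => (qmgetD CS c col : ℝ) with hCSr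
  set v : Fin (m * winLen Kb Ka) → ℝ := CSr.mulVec ξ + e with hvdef
  set Λ : Fin (m * winLen Kb Ka) → ℝ := fun d => (Lam.getD d 0 : ℝ) with hΛ
  set A : ℝ := ∑ d, Λ d * x d with hAdef
  have hCsR : (0 : ℝ) < (Cs : ℝ) := by exact_mod_cast hCs
  have hr0 : ∀ col : Fin (m * winLen Kb Ka), 0 ≤ (dgetD rD col).toReal := fun col => (abs_nonneg _).trans (hξ col)
  have hE0 : ∀ c : Fin (m * winLen Kb Ka), (0 : ℝ) ≤ (ES.getD c 0 : ℝ) := fun c => (abs_nonneg _).trans (he c)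
  have hxv : ∀ d, x d = (XS.getD d 0 : ℝ) + v d := fun d => by
    have := congrArg (fun g => g d) hx; simpa [hvdef] using this
  -- casts of the rational pieces
  have hAhR : (Ah : ℝ) = ∑ d : Fin (m * winLen Kb Ka), Λ d * (XS.getD d 0 : ℝ) := by
    simp only [hAh, ahatQ, hΛ]; push_cast; rfl
  have hACR : ∀ col : Fin (m * winLen Kb Ka), (AC.getD col 0 : ℝ) = ∑ d, Λ d * CSr d col := fun col => by
    simp only [hAC, acArr, getD_ofFn, hΛ, hCSr, Matrix.of_apply]; push_cast; rfl
  have hdAR : (dA : ℝ) = (∑ col : Fin (m * winLen Kb Ka), |(AC.getD col 0 : ℝ)| * (dgetD rD col).toReal) +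
      ∑ d : Fin (m * winLen Kb Ka), |Λ d| * (ES.getD d 0 : ℝ) := by
    simp only [hdA, dAQ, hΛ]; push_cast; simp only [cast_dyadToRat]
  have hRSR : ∀ d : Fin (m * winLen Kb Ka), (rsRowQ (m * winLen Kb Ka) CS rD ES d : ℝ) =
      (∑ col, |CSr d col| * (dgetD rD col).toReal) + (ES.getD d 0 : ℝ) := fun d => by
    simp only [rsRowQ, hCSr, Matrix.of_apply]; push_cast; simp only [cast_dyadToRat]
  -- the amplitude functional on the node
  have hAv : A - (Ah : ℝ) = (∑ col : Fin (m * winLen Kb Ka), (AC.getD col 0 : ℝ) * ξ col) + ∑ d : Fin (m * winLen Kb Ka), Λ d * e d := by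
    have e1 : A - (Ah : ℝ) = ∑ d, Λ d * v d := by
      rw [hAdef, hAhR, ← Finset.sum_sub_distrib]
      exact Finset.sum_congr rfl fun d _ => by rw [hxv d]; ring
    rw [e1]
    have e2 : ∀ d : Fin (m * winLen Kb Ka), Λ d * v d = (∑ col : Fin (m * winLen Kb Ka), Λ d * CSr d col * ξ col) + Λ d * e d := fun d => by
      simp only [hvdef, Pi.add_apply, Matrix.mulVec, dotProduct, mul_add, Finset.mul_sum]
      congr 1; exact Finset.sum_congr rfl fun _ _ => by ring
    simp only [e2, Finset.sum_add_distrib]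
    congr 1
    rw [Finset.sum_comm]
    exact Finset.sum_congr rfl fun col _ => by rw [hACR col, Finset.sum_mul]
  have hAbound : |A - (Ah : ℝ)| ≤ (dA : ℝ) := by
    rw [hAv, hdAR]; exact abs_pair_sum_le hξ he
  have hdA0 : (0 : ℝ) ≤ (dA : ℝ) := (abs_nonneg _).trans hAbound
  have hAloR : ((Ah - dA : ℚ) : ℝ) ≤ A := by push_cast; have := (abs_le.mp hAbound).1; linarith
  have hAhiR : A ≤ ((Ah + dA : ℚ) : ℝ) := by push_cast; have := (abs_le.mp hAbound).2; linarith
  have hAlo0 : (0 : ℝ) < ((Ah - dA : ℚ) : ℝ) := by exact_mod_cast hAlo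
  have hApos : 0 < A := hAlo0.trans_le hAloR
  have hAhpos : (0 : ℝ) < (Ah : ℝ) := by push_cast at hAlo0; linarith
  -- the node's box extent
  have hvbound : ∀ d, |v d| ≤ (rsRowQ (m * winLen Kb Ka) CS rD ES d : ℝ) := fun d => by
    rw [hRSR d]
    simp only [hvdef, Pi.add_apply, Matrix.mulVec, dotProduct]
    refine (abs_add_le _ _).trans (add_le_add ?_ (he d))
    refine (Finset.abs_sum_le_sum_abs _ _).trans (Finset.sum_le_sum fun col _ => ?_)
    rw [abs_mul]; exact mul_le_mul_of_nonneg_left (hξ col) (abs_nonneg _)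
  -- the window values from the coordinates
  have hval : ∀ (i : Fin m) (k : ℤ) (hw : -Kb ≤ k ∧ k ≤ Ka), y i k = ω i k * x (idxOf Kb Ka i k hw) := fun i k hw => by
    have hωk : (0 : ℝ) < ω i k := by simp only [hωdef]; exact_mod_cast hω i k
    rw [hxdef, pxcoord_idxOf y i hw]; field_simp
  have hbounds : ∀ (i : Fin m) (k : ℤ) (hw : -Kb ≤ k ∧ k ≤ Ka),
      |y i k| ≤ ω i k * (|(XS.getD ((k + Kb).toNat + winLen Kb Ka * i.val) 0 : ℝ)| +
        (rsRowQ (m * winLen Kb Ka) CS rD ES ((k + Kb).toNat + winLen Kb Ka * i.val) : ℝ)) ∧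
      ω i k * (|(XS.getD ((k + Kb).toNat + winLen Kb Ka * i.val) 0 : ℝ)| -
        (rsRowQ (m * winLen Kb Ka) CS rD ES ((k + Kb).toNat + winLen Kb Ka * i.val) : ℝ)) ≤ |y i k| := by
    intro i k hw
    have hωk : (0 : ℝ) < ω i k := by simp only [hωdef]; exact_mod_cast hω i k
    rw [hval i k hw, abs_mul, abs_of_pos hωk, ← idxOf_val i hw]
    set d := idxOf Kb Ka i k hw
    have h1 : |x d| ≤ |(XS.getD d 0 : ℝ)| + (rsRowQ (m * winLen Kb Ka) CS rD ES d : ℝ) := by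
      rw [hxv d]; exact (abs_add_le _ _).trans (add_le_add le_rfl (hvbound d))
    have h2 : |(XS.getD d 0 : ℝ)| - (rsRowQ (m * winLen Kb Ka) CS rD ES d : ℝ) ≤ |x d| := by
      rw [hxv d]; have := abs_sub_abs_le_abs_sub ((XS.getD d 0 : ℝ) + v d) (v d); rw [add_sub_cancel_right] at this
      have h3 := hvbound d
      have h4 : |(XS.getD d 0 : ℝ)| - |v d| ≤ |(XS.getD d 0 : ℝ) + v d| := by
        have := abs_add_le ((XS.getD d 0 : ℝ) + v d) (-v d); rw [add_neg_cancel_right, abs_neg] at this; linarith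
      linarith
    exact ⟨mul_le_mul_of_nonneg_left h1 hωk.le, mul_le_mul_of_nonneg_left h2 hωk.le⟩
  -- the amplitude and the reference state
  set a' : ℝ := A / (Cs : ℝ) with ha'
  have ha'pos : 0 < a' := div_pos hApos hCsR
  have ha'lo : (((Ah - dA) / Cs : ℚ) : ℝ) ≤ a' := by
    rw [ha', Rat.cast_div]; exact div_le_div_of_nonneg_right hAloR hCsR.le
  have ha'hi : a' ≤ (((Ah + dA) / Cs : ℚ) : ℝ) := by
    rw [ha', Rat.cast_div]; exact div_le_div_of_nonneg_right hAhiR hCsR.le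
  -- read value at `(i,k)`: `P_{i,k} := y_{i,k+1}/A` for `k + 1 ≤ Ka`, `0` at `k = Ka`
  set P : Fin m → ℤ → ℝ := fun i k => if k + 1 ≤ Ka then y i (k + 1) / A else 0 with hP
  set z' : Fin m → ℤ → ℝ := fun i k => if h : -Kb ≤ k ∧ k ≤ Ka then
      (Cs : ℝ) * clipR (dgetD cen (idxOf Kb Ka i k h)).toReal (dgetD chw (idxOf Kb Ka i k h)).toReal (P i k) else 0 with hz'
  -- `0 ≤ w_k` and `0 ≤ chw` on the window, from the matching loop
  have hwin : ∀ (i : Fin m) (k : ℤ) (hw : -Kb ≤ k ∧ k ≤ Ka), 0 ≤ wq k ∧ 0 ≤ dyadToRat (dgetD chw (idxOf Kb Ka i k hw)) ∧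
      (Ka < k + 1 ∨ wq k * Cs * (|ωq i (k + 1) * XS.getD ((k + 1 + Kb).toNat + winLen Kb Ka * i.val) 0 / Ah -
          dyadToRat (dgetD cen (idxOf Kb Ka i k hw))| +
        ωq i (k + 1) * nMatchQ (m * winLen Kb Ka) Lam AC Ah XS CS rD ES ((k + 1 + Kb).toNat + winLen Kb Ka * i.val) / ((Ah - dA) * Ah) -
          dyadToRat (dgetD chw (idxOf Kb Ka i k hw))) ≤ ρ * r) := by
    intro i k hw
    have hcc : (k + Kb).toNat < winLen Kb Ka := by unfold winLen; rw [Int.toNat_lt_toNat (by omega)]; omega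
    obtain ⟨⟨hwk, hchw⟩, hor⟩ := hmatch i (k + Kb).toNat hcc
    rw [Int.toNat_of_nonneg (by omega), show k + Kb - Kb = k by ring] at hwk hchw hor
    rw [idxOf_val i hw]
    exact ⟨hwk, hchw, hor⟩
  have hcoreZ : InCoreBox Kb Ka Cs cen chw z' := by
    refine ⟨fun i k hk => by simp only [hz']; rw [dif_neg hk], fun i k hw => ?_⟩
    simp only [hz']; rw [dif_pos hw]
    have hchw : (0 : ℝ) ≤ (dgetD chw (idxOf Kb Ka i k hw)).toReal := by
      rw [← cast_dyadToRat]; exact_mod_cast (hwin i k hw).2.1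
    rw [← mul_sub, abs_mul, abs_of_pos hCsR]
    exact mul_le_mul_of_nonneg_left (abs_clipR_sub_le hchw _) hCsR.le
  refine ⟨a', z', ha'pos, ?_, ?_, hcoreL z' hcoreZ, fun i k hk1 hk2 => ?_, fun i w hw => ?_, fun i => ?_⟩
  · -- floor
    have halo : (0 : ℚ) < (Ah - dA) / Cs := div_pos hAlo hCs
    exact (floor_of_pow_test hq hθd halo hfl).trans ha'lo
  · -- slack at `(i₀, 1)`
    have h := (hbounds i₀ 1 h1w).2
    have hsl2r := (Rat.cast_le (K := ℝ)).mpr hsl2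
    push_cast at hsl2r h
    have hσ1r : (0 : ℝ) ≤ 1 + (σ : ℝ) := by exact_mod_cast hσ1
    have h3 : (1 + (σ : ℝ)) * a' ≤ (1 + (σ : ℝ)) * ((((Ah + dA) / Cs : ℚ)) : ℝ) := mul_le_mul_of_nonneg_left ha'hi hσ1r
    push_cast at h3
    simp only [hωdef] at h
    linarith
  · -- matching at `(i, 1+k)` against the box entry at `(i, k)`
    have hw0 : -Kb ≤ k ∧ k ≤ Ka := ⟨hk1, by omega⟩
    have hw1 : -Kb ≤ k + 1 ∧ k + 1 ≤ Ka := ⟨by omega, hk2⟩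
    obtain ⟨hwk, hchw, hor⟩ := hwin i k hw0
    rcases hor with hbad | hm
    · exact absurd hbad (by omega)
    have hwkR : (0 : ℝ) ≤ (wq k : ℝ) := by exact_mod_cast hwk
    have hchwR : (0 : ℝ) ≤ (dgetD chw (idxOf Kb Ka i k hw0)).toReal := by rw [← cast_dyadToRat]; exact_mod_cast hchw
    have hρrR : (0 : ℝ) ≤ (ρ : ℝ) * (r : ℝ) := by exact_mod_cast hρr
    set dp := idxOf Kb Ka i (k + 1) hw1 with hdp
    set cn : ℝ := (dgetD cen (idxOf Kb Ka i k hw0)).toReal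
    set hwd : ℝ := (dgetD chw (idxOf Kb Ka i k hw0)).toReal
    have hz'v : z' i k = (Cs : ℝ) * clipR cn hwd (P i k) := by simp only [hz']; rw [dif_pos hw0]
    have hPv : P i k = y i (k + 1) / A := by simp only [hP]; rw [if_pos hk2]
    have h1k : y i (1 + k) = y i (k + 1) := by rw [add_comm]
    -- `y/a' − z' = Cs (P − clip P)`
    have hdiff : y i (1 + k) / a' - z' i k = (Cs : ℝ) * (P i k - clipR cn hwd (P i k)) := by
      rw [h1k, hz'v, hPv, ha']; field_simp
    rw [hdiff, abs_mul, abs_of_pos hCsR]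
    -- `P = ω x_{d⁺}/A`, `P̂ = ω XS_{d⁺}/Â`
    have hωk : (0 : ℝ) < ω i (k + 1) := by simp only [hωdef]; exact_mod_cast hω i (k + 1)
    have hPx : P i k = ω i (k + 1) * x dp / A := by rw [hPv, hval i (k + 1) hw1]
    set Ph : ℝ := ω i (k + 1) * (XS.getD dp 0 : ℝ) / (Ah : ℝ) with hPh
    -- the key identity and the numerator bound
    have hkey : P i k - Ph = ω i (k + 1) * ((Ah : ℝ) * v dp - (XS.getD dp 0 : ℝ) * (A - Ah)) / (A * (Ah : ℝ)) := by
      rw [hPx, hPh, hxv dp]; field_simp; ring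
    have hnumid : (Ah : ℝ) * v dp - (XS.getD dp 0 : ℝ) * (A - (Ah : ℝ)) =
        (∑ col : Fin (m * winLen Kb Ka), ((Ah : ℝ) * CSr dp col - (XS.getD dp 0 : ℝ) * (AC.getD col 0 : ℝ)) * ξ col) +
          ∑ j : Fin (m * winLen Kb Ka), ((Ah : ℝ) * (if (j : ℕ) = (dp : ℕ) then (1 : ℝ) else 0) - (XS.getD dp 0 : ℝ) * Λ j) * e j := by
      rw [hAv, hvdef, mulVec_add_apply_kron]
      exact match_numerator_identity _ _ _ _ _ _ _ _
    have hN : |(Ah : ℝ) * v dp - (XS.getD dp 0 : ℝ) * (A - (Ah : ℝ))| ≤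
        (nMatchQ (m * winLen Kb Ka) Lam AC Ah XS CS rD ES dp : ℝ) := by
      rw [hnumid]
      refine (abs_pair_sum_le hξ he).trans (le_of_eq ?_)
      simp only [nMatchQ, hΛ, hCSr, Matrix.of_apply]; push_cast; simp only [cast_dyadToRat, cast_kronQ]
    have hN0 : (0 : ℝ) ≤ (nMatchQ (m * winLen Kb Ka) Lam AC Ah XS CS rD ES dp : ℝ) := (abs_nonneg _).trans hN
    have hspr : |P i k - Ph| ≤ ω i (k + 1) * (nMatchQ (m * winLen Kb Ka) Lam AC Ah XS CS rD ES dp : ℝ) / (((Ah - dA : ℚ) : ℝ) * (Ah : ℝ)) := by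
      rw [hkey, abs_div, abs_mul, abs_of_pos hωk, abs_of_pos (mul_pos hApos hAhpos)]
      calc ω i (k + 1) * |(Ah : ℝ) * v dp - (XS.getD dp 0 : ℝ) * (A - (Ah : ℝ))| / (A * (Ah : ℝ))
          ≤ ω i (k + 1) * (nMatchQ (m * winLen Kb Ka) Lam AC Ah XS CS rD ES dp : ℝ) / (A * (Ah : ℝ)) :=
            div_le_div_of_nonneg_right (mul_le_mul_of_nonneg_left hN hωk.le) (mul_pos hApos hAhpos).le
        _ ≤ ω i (k + 1) * (nMatchQ (m * winLen Kb Ka) Lam AC Ah XS CS rD ES dp : ℝ) / (((Ah - dA : ℚ) : ℝ) * (Ah : ℝ)) := by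
            refine div_le_div_of_nonneg_left (mul_nonneg hωk.le hN0) (mul_pos hAlo0 hAhpos) ?_
            exact mul_le_mul_of_nonneg_right hAloR hAhpos.le
    -- the clipping distance
    have hclip := abs_sub_clipR_le cn hwd (P i k) hchwR
    have htri : |P i k - cn| ≤ |Ph - cn| + |P i k - Ph| := by
      have := abs_add_le (Ph - cn) (P i k - Ph); rw [show Ph - cn + (P i k - Ph) = P i k - cn by ring] at this; linarith
    have hmR := (Rat.cast_le (K := ℝ)).mpr hm
    simp only [Rat.cast_mul, Rat.cast_add, Rat.cast_sub, Rat.cast_abs, Rat.cast_div, cast_dyadToRat] at hmR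
    rw [← idxOf_val i hw1] at hmR
    -- case split on the sign of the bracket
    set X : ℝ := |Ph - cn| + ω i (k + 1) * (nMatchQ (m * winLen Kb Ka) Lam AC Ah XS CS rD ES dp : ℝ) / (((Ah - dA : ℚ) : ℝ) * (Ah : ℝ)) - hwd
      with hX
    have hXb : max (|P i k - cn| - hwd) 0 ≤ max X 0 := max_le_max (by rw [hX]; linarith) le_rfl
    have hle : |P i k - clipR cn hwd (P i k)| ≤ max X 0 := hclip.trans hXb
    rcases le_total 0 X with hX0 | hX0
    · rw [max_eq_left hX0] at hle
      have hmR' : (wq k : ℝ) * (Cs : ℝ) * X ≤ (ρ : ℝ) * (r : ℝ) := by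
        have e : X = |ω i (k + 1) * (XS.getD dp 0 : ℝ) / (Ah : ℝ) - cn| +
            ω i (k + 1) * (nMatchQ (m * winLen Kb Ka) Lam AC Ah XS CS rD ES dp : ℝ) / (((Ah : ℝ) - (dA : ℝ)) * (Ah : ℝ)) - hwd := by
          rw [hX, hPh]; push_cast; rfl
        rw [e]; simp only [hωdef]; exact hmR
      calc (wq k : ℝ) * ((Cs : ℝ) * |P i k - clipR cn hwd (P i k)|)
          ≤ (wq k : ℝ) * ((Cs : ℝ) * X) := mul_le_mul_of_nonneg_left (mul_le_mul_of_nonneg_left hle hCsR.le) hwkR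
        _ = (wq k : ℝ) * (Cs : ℝ) * X := by ring
        _ ≤ (ρ : ℝ) * (r : ℝ) := hmR'
    · rw [max_eq_right hX0] at hle
      have h0 : |P i k - clipR cn hwd (P i k)| = 0 := le_antisymm hle (abs_nonneg _)
      rw [h0, mul_zero, mul_zero]; exact hρrR
  · -- top
    obtain ⟨⟨hchwT, htop⟩, -⟩ := htopexit i
    have hwK : -Kb ≤ Ka ∧ Ka ≤ Ka := ⟨by omega, le_rfl⟩
    set cn : ℝ := (dgetD cen (idxOf Kb Ka i Ka hwK)).toReal
    set hwd : ℝ := (dgetD chw (idxOf Kb Ka i Ka hwK)).toReal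
    have hchwR : 0 ≤ hwd := by simp only [hwd]; rw [← cast_dyadToRat, ← idxOf_val i hwK] at *; exact_mod_cast hchwT
    have hz'v : z' i Ka = (Cs : ℝ) * clipR cn hwd 0 := by
      simp only [hz']; rw [dif_pos hwK]; simp only [hP]; rw [if_neg (by omega)]
    have htopR := (Rat.cast_le (K := ℝ)).mpr htop
    simp only [Rat.cast_mul, Rat.cast_add, Rat.cast_abs, Rat.cast_div, Rat.cast_sub, Rat.cast_max, Rat.cast_zero, cast_dyadToRat] at htopR
    rw [← idxOf_val i hwK] at htopR
    -- `0 ≤ wq Ka` from the window loop at `k = Ka`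
    have hwKR : (0 : ℝ) ≤ (wq Ka : ℝ) := by exact_mod_cast (hwin i Ka hwK).1
    have hEt0 : (0 : ℝ) ≤ (Et : ℝ) := (abs_nonneg _).trans hw
    have htri : |w / a' - z' i Ka| ≤ (Et : ℝ) * (Cs : ℝ) / (((Ah - dA : ℚ) : ℝ)) + (Cs : ℝ) * max (|cn| - hwd) 0 := by
      rw [hz'v]
      refine (abs_sub _ _).trans (add_le_add ?_ ?_)
      · rw [abs_div, abs_of_pos ha'pos, ha', div_div_eq_mul_div]
        calc |w| * (Cs : ℝ) / A ≤ (Et : ℝ) * (Cs : ℝ) / A := div_le_div_of_nonneg_right (mul_le_mul_of_nonneg_right hw hCsR.le) hApos.le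
          _ ≤ (Et : ℝ) * (Cs : ℝ) / (((Ah - dA : ℚ) : ℝ)) := div_le_div_of_nonneg_left (mul_nonneg hEt0 hCsR.le) hAlo0 hAloR
      · rw [abs_mul, abs_of_pos hCsR]; exact mul_le_mul_of_nonneg_left (abs_clipR_zero_le hchwR) hCsR.le
    have htopR' : (wq Ka : ℝ) * ((Et : ℝ) * (Cs : ℝ) / (((Ah - dA : ℚ) : ℝ)) + (Cs : ℝ) * max (|cn| - hwd) 0) ≤ (ρ : ℝ) * (r : ℝ) := by
      push_cast; exact htopR
    exact (mul_le_mul_of_nonneg_left htri hwKR).trans htopR'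
  · -- exit at `(i, −Kb)`
    obtain ⟨-, hex⟩ := htopexit i
    have hwB : -Kb ≤ -Kb ∧ -Kb ≤ Ka := ⟨le_rfl, by omega⟩
    have h := (hbounds i (-Kb) hwB).1
    have hexR := (Rat.cast_le (K := ℝ)).mpr hex
    simp only [Rat.cast_mul, Rat.cast_add, Rat.cast_abs] at hexR
    have hZxR : (0 : ℝ) ≤ (Zx : ℝ) := by exact_mod_cast hZx
    simp only [hωdef] at h
    exact h.trans (hexR.trans (mul_le_mul_of_nonneg_right ha'lo hZxR))

end CertificateGlueOn

end Summit.NavierStokesRegularity.NavierStokesRegularity.Theorems
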